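import Literature.MathematicalPhysics.KineticTheory.DampedHarmonicBlockObservability
import Literature.MathematicalPhysics.KineticTheory.CellChainLangevin
import Summits.AtomisticToContinuum.FouriersLaw.Theses.MatthiessenLadder
import HarnessLib

/-!
# Observability of the damped harmonic host block with the interface site as a bounded forcing

Helper for crux `PrefixSteadyStates` (route `MatthiessenLadder`, item stmt-AtomisticToContinuum-12778,
registered stub `stub_prefixHostObservability` of the line `registered`, skeleton r12). In the mixed
rung `cellChain ω₂ lam β γ (· < k)`, `0 < k < N`, the host sites `k+1, …, N-1` (relabelled
`j = 0, …, n-1`, `n = N-1-k ≥ 1`) carry harmonic pinning `ω₂ q²/2`, unit harmonic bonds, the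
friction `γ` and the right bath noise `ξ` at the last site, and the first of them is tied by a unit
harmonic bond to the interface position `u(t) = q_k(t)`, treated as a prescribed continuous forcing.
The statement: for `ω₂, γ, τ > 0` there are `c₀ > 0`, `C₀ ≥ 0` such that every continuous solution
on `[0, τ]` of the host-block integral equation with `|u| ≤ Mu`, `|ξ| ≤ Mξ` dissipates
`γ ∫₀^τ (p_{n-1} - ξ)² ≥ c₀ ∑_j (q_j(0)² + p_j(0)²) - C₀ (Mu² + Mξ²)`.

Proof: the displayed field is `A X + (0, u e_0)` for the block operator `A` of
`Literature/MathematicalPhysics/KineticTheory/DampedHarmonicBlockObservability.lean`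
(`exists_hostBlockOp`), whose forced observability estimate `hostBlock_observability_forced`
(Grönwall comparison with the free linear flow `exp(tA) X(0)` + the observability inequality of
`(A, p_{n-1})`, `Literature/Analysis/ODE/LinearObservability.lean`) gives the bound with the sup norm
`‖X(0)‖²`; `∑_j (q_j² + p_j²) ≤ 2n ‖X(0)‖²` (`phaseNormSq_le`) converts it.
-/

noncomputable section

open MeasureTheory Filter Topology
open scoped NNReal ENNReal

namespace Summit.AtomisticToContinuum.FouriersLaw.Theorems.PrefixSteadyStates.LineRegistered

open Literature.MathematicalPhysics.KineticTheory.HeatConduction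

/-- **Registered stub `stub_prefixHostObservability` of crux `PrefixSteadyStates` (line
`registered`, r12): observability of the damped harmonic host block from the friction at its last
site, with the interface position and the bath noise as bounded forcings.** For `ω₂, γ, τ > 0` and
`n ≥ 1` there are `c₀ > 0`, `C₀ ≥ 0` such that every continuous solution `X = (q, p)` on `[0, τ]` of
`X(t) = X(0) + (0, ξ(t) e_{n-1}) + ∫₀ᵗ (p, F(q, u) - γ p_{n-1} e_{n-1}) ds`,
`F_j(q, u) = -ω₂ q_j + [j+1<n](q_{j+1} - q_j) - [j>0](q_j - q_{j-1}) - [j=0](q_0 - u)`, with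
continuous `|u| ≤ Mu`, `|ξ| ≤ Mξ` on `[0, τ]`, satisfies
`c₀ ∑_j (q_j(0)² + p_j(0)²) - C₀ (Mu² + Mξ²) ≤ γ ∫₀^τ (p_{n-1}(s) - ξ(s))² ds`.
By `hostBlock_observability_forced` (variation of constants, Grönwall, compactness of the unit
sphere, rigidity of the block observed at its last momentum). [folklore] -/
theorem stub_prefixHostObservability :
    ∀ ω₂ γ τ : ℝ, 0 < ω₂ → 0 < γ → 0 < τ → ∀ n : ℕ, ∀ hn : 0 < n,
      ∃ c₀ C₀ : ℝ, 0 < c₀ ∧ 0 ≤ C₀ ∧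
        ∀ (Mu Mξ : ℝ) (u ξ : ℝ → ℝ) (X : ℝ → PhaseSpace n),
          Continuous u → Continuous ξ → Continuous X →
          (∀ t ∈ Set.Icc (0 : ℝ) τ, |u t| ≤ Mu) → (∀ t ∈ Set.Icc (0 : ℝ) τ, |ξ t| ≤ Mξ) →
          (∀ t ∈ Set.Icc (0 : ℝ) τ,
            X t = X 0 + ((0 : Fin n → ℝ), fun j : Fin n => if j.val = n - 1 then ξ t else 0) +
              ∫ s in (0 : ℝ)..t,
                ((X s).2, fun j : Fin n =>
                  -(ω₂ * (X s).1 j) +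
                    (if h : j.val + 1 < n then (X s).1 ⟨j.val + 1, h⟩ - (X s).1 j else 0) -
                    (if h : 0 < j.val then (X s).1 j - (X s).1 ⟨j.val - 1, by omega⟩
                      else (X s).1 j - u s) -
                    (if j.val = n - 1 then γ * (X s).2 j else 0))) →
          c₀ * (∑ j, ((X 0).1 j ^ 2 + (X 0).2 j ^ 2)) - C₀ * (Mu ^ 2 + Mξ ^ 2) ≤
            γ * ∫ s in (0 : ℝ)..τ, ((X s).2 ⟨n - 1, by omega⟩ - ξ s) ^ 2 := by
  intro ω₂ γ τ hω hγ hτ n hn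
  obtain ⟨A, hA⟩ := exists_hostBlockOp ω₂ γ n
  obtain ⟨c, C, hc, hC, hmain⟩ := hostBlock_observability_forced hn hω hτ A hA
  have hn' : (0 : ℝ) < n := Nat.cast_pos.2 hn
  refine ⟨γ * c / (2 * n), γ * C, by positivity, mul_nonneg hγ.le hC, ?_⟩
  intro Mu Mξ u ξ X hu hξ hXc hMu hMξ hXeq
  have hXeq' : ∀ t ∈ Set.Icc (0 : ℝ) τ,
      X t = X 0 + ((0 : Fin n → ℝ), fun j : Fin n => if j.val = n - 1 then ξ t else 0) +
        ∫ s in (0 : ℝ)..t,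
          (A (X s) + ((0 : Fin n → ℝ), fun j : Fin n => if 0 < j.val then 0 else u s)) := by
    intro t ht
    rw [hXeq t ht]
    congr 1
    refine intervalIntegral.integral_congr fun s _ => ?_
    rw [hA (X s)]
    refine Prod.ext (by simp) (funext fun j => ?_)
    simp only [Prod.snd_add, Pi.add_apply]
    split_ifs <;> ring
  have h := hmain Mu Mξ u ξ X hu hξ hXc hMu hMξ hXeq'
  have hS : ∑ j, ((X 0).1 j ^ 2 + (X 0).2 j ^ 2) ≤ 2 * n * ‖X 0‖ ^ 2 := phaseNormSq_le (X 0)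
  have h1 : γ * c / (2 * n) * ∑ j, ((X 0).1 j ^ 2 + (X 0).2 j ^ 2) ≤ γ * c * ‖X 0‖ ^ 2 :=
    calc γ * c / (2 * n) * ∑ j, ((X 0).1 j ^ 2 + (X 0).2 j ^ 2)
        ≤ γ * c / (2 * n) * (2 * n * ‖X 0‖ ^ 2) := mul_le_mul_of_nonneg_left hS (by positivity)
      _ = γ * c * ‖X 0‖ ^ 2 := by field_simp
  have h2 := mul_le_mul_of_nonneg_left h hγ.le
  linarith

end Summit.AtomisticToContinuum.FouriersLaw.Theorems.PrefixSteadyStates.LineRegistered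

end
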